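import Summits.MatrixMultiplication.OmegaCensus.STPPVosperSlackTwoRows59L2TblB1

/-!
# ω-census (abelian STPP census): ℤ₅₉ leaf L2 — dead-table rows for case B (`tblZ59L2B`) — table rows assembled

HONEST FRAMING (pub-omega census; verbatim): lottery ticket; floor = certified bounds/negative ranges.
Census STRUCTURE (seat pub-omega-stpp-2 gen 27, 2026-08-29), family (b2).  `dead59L2B : ∀ e ∈ tblZ59L2B, … = false` glued from 5 chunk theorems.  No new computation.
Nothing here is progress on `ω`.
-/

namespace Summit.MatrixMultiplication.OmegaCensus.CubeNB.S2

open Summit.MatrixMultiplication.OmegaCensus.CubeNB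

/-- **Dead table `tblZ59L2B`**: every entry's words-cover search fails. [folklore] -/
theorem dead59L2B : ∀ e ∈ tblZ59L2B, existsCoverW 59 e.1 e.2 [blockDiffsWQ 59 e.1 e.2 2 3 2, blockDiffsWQ 59 e.1 e.2 3 2 4] [] [] [] = false := by
  have h10 : ∀ e ∈ tblZ59L2B.drop 10, existsCoverW 59 e.1 e.2 [blockDiffsWQ 59 e.1 e.2 2 3 2, blockDiffsWQ 59 e.1 e.2 3 2 4] [] [] [] = false := by
    intro e he
    rw [show tblZ59L2B.drop 10 = [] from by decide] at he
    exact absurd he List.not_mem_nil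
  have h8 : ∀ e ∈ tblZ59L2B.drop 8, existsCoverW 59 e.1 e.2 [blockDiffsWQ 59 e.1 e.2 2 3 2, blockDiffsWQ 59 e.1 e.2 3 2 4] [] [] [] = false :=
    forall_drop_of_take_drop _ 8 2 dead59L2B_c4 (by rw [show 8 + 2 = 10 from rfl]; exact h10)
  have h6 : ∀ e ∈ tblZ59L2B.drop 6, existsCoverW 59 e.1 e.2 [blockDiffsWQ 59 e.1 e.2 2 3 2, blockDiffsWQ 59 e.1 e.2 3 2 4] [] [] [] = false :=
    forall_drop_of_take_drop _ 6 2 dead59L2B_c3 (by rw [show 6 + 2 = 8 from rfl]; exact h8)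
  have h4 : ∀ e ∈ tblZ59L2B.drop 4, existsCoverW 59 e.1 e.2 [blockDiffsWQ 59 e.1 e.2 2 3 2, blockDiffsWQ 59 e.1 e.2 3 2 4] [] [] [] = false :=
    forall_drop_of_take_drop _ 4 2 dead59L2B_c2 (by rw [show 4 + 2 = 6 from rfl]; exact h6)
  have h2 : ∀ e ∈ tblZ59L2B.drop 2, existsCoverW 59 e.1 e.2 [blockDiffsWQ 59 e.1 e.2 2 3 2, blockDiffsWQ 59 e.1 e.2 3 2 4] [] [] [] = false :=
    forall_drop_of_take_drop _ 2 2 dead59L2B_c1 (by rw [show 2 + 2 = 4 from rfl]; exact h4)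
  have h0 : ∀ e ∈ tblZ59L2B.drop 0, existsCoverW 59 e.1 e.2 [blockDiffsWQ 59 e.1 e.2 2 3 2, blockDiffsWQ 59 e.1 e.2 3 2 4] [] [] [] = false :=
    forall_drop_of_take_drop _ 0 2 dead59L2B_c0 (by rw [show 0 + 2 = 2 from rfl]; exact h2)
  intro e he
  exact h0 e (by rwa [List.drop_zero])

end Summit.MatrixMultiplication.OmegaCensus.CubeNB.S2
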